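import Summits.QuantumFields.BalabanUV.Beta.GAN24.ThreeFaceUnroll
import Summits.QuantumFields.BalabanUV.Beta.GAN24.LambdaPieceThreeFace

/-!
# `BalabanUV.Beta.GAN24.ThreeFaceUnrollSrec` — binder row G-an2-4 ∕ (CONV-C), W-slot CT-W, route «WC-TL», the table fact «3F-REC»:
# **THE UNROLLING IDENTITY AT THE LEVEL OF THE FOLDED TABLE** — `3F_{j+1}^{(P)}[SrecAt] = (cE·wE_{j+1})·cH_j³·3F_j^{(Lc·P)}[SrecAt] + (cΛ·wΛ_{j+1})·ΛF_{j+1}^{(P)}`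

NOT IN PRINT; OUR BOOKKEEPING ([folklore] bookkeeping BY NAME over `ThreeFaceUnroll.threeFace_e3OfK_unroll` and `WardLocusRecursive.SrecAt_succ`; G-an2-4 formalisation
swarm, leaf prover `b2b-balaban-gan24-formalise-leaf-04`, gen 62).  HONEST FRAMING (cell contract, verbatim): «discharging `BetaPertH` makes Bałaban's UV stability
UNCONDITIONAL — a real constructive-QFT result; it is NOT the continuum limit and NOT the Clay problem.»  HONEST DEPENDENCY (verbatim): «continuum YM on T⁴ ⇐
BetaPertH ∧ nine spine estimates (0/9 proved); BetaPertH ⇐ (D1) ∧ (D4) ∧ CAP+tail; G-an2-4 gates asym, D1 and NE2/3/4.»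

WHAT ([folklore]; 0 `def`, 0 cited facts, 0 `def … : Prop`, 0 sorry; generic `d`, every `j`, every in-block root, every period `P ≥ 1`; pair summability from `LambdaPieceThreeFace.summable_weighted_pairs`):
**`threeFace_SrecAt_succ_unroll`** — the three-face-legs cell form with period-`P` exit faces of the folded member `SrecAt … (j+1)` equals
`(cE·wE d Lc (j+1))·cH_j³ ·` (the same form of `SrecAt … j` with period-`Lc·P` exit faces) `+ (cΛ·wΛ d Lc (j+1)) ·` (the same form of the Λ-piece
`SLam Lc (lamCoeffK (KInvStep Lc (j+1)) (E2 d Lc (j+1)) Lc) hessFFAt`): split along `SrecAt_succ` (the rooted border is OFF the ff block, `packVH_inl_inl`; the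
Λ family is pair-summable as a difference of two bi-localised families), cubic sector by `threeFace_e3OfK_unroll`.
READING.  Iterating from `P = Lc` at the top level down to level `0`: «3F-REC» (this lineage's `SpureRecLegChargeThreeFace`, hypothesis `h3F`) ⟸ the level-0
three-face laws of `S0NAt` with exit faces of every period `Lc^k` (cubic Wilson part: EXACT in rationals at D = 2,3,4, engine R-leaf04-g62-2; level-0 Λ-part) AND
the face laws of the Λ-pieces at every level ((T-H)_face; engine: zero at every slot) — NOT assembled here (the level-0 and Λ letters are not typed).
Asserts NO value of Bałaban's tables; discharges NOTHING of «3F-REC» ∕ «S3C-REC» ∕ F2a-comb ∕ (C)sym ∕ (Q-D) ∕ (Q-D-rate) ∕ «T2Shape» ∕ «T2Drift» ∕ (hW, hWall);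
NOT «D1 closed»; NEVER «G-an2-4 closed» as (CONV-C); NOT D1, NOT `BetaPertH`, NOT continuum, NOT Clay.  2026-08-22; no existing file touched.
-/

noncomputable section

open Finset
open scoped BigOperators
open Literature.MathematicalPhysics.QuantumFieldTheory
open Literature.MathematicalPhysics.QuantumFieldTheory.Balaban1983to89
open Literature.MathematicalPhysics.QuantumFieldTheory.Balaban1983to89.Beta
open B12Sec2to5 (l1)
open ExpKernelCalculus (Site MKer BiLoc)
open AffineAveraging (box toSite)
open OneStepResolventKernel (Fib LocStencil)
open OneStepKernelFamily (KInvStep)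
open BalabanStepJetsSucc (wE wΛ lamCoeffK E2)
open InterLevelTransport (SLam)
open AveragingHessianKernels (packVH_inl_inl)
open AveragingHessianKernelsRooted (hessFFAt)
open Summit.QuantumFields.BalabanUV.Beta.AxialDressingRooted (coDressKBmAt decays_coDressKBmAt_KInvStep)
open Summit.QuantumFields.BalabanUV.Beta.BorderedHessian (stepScale)
open Summit.QuantumFields.BalabanUV.Beta.WardLocusRecursive (SrecAt locStencil_SrecAt SrecAt_succ)
open Summit.QuantumFields.BalabanUV.Beta.SpineRooted (e3OfK locStencil_e3OfK)

namespace Summit.QuantumFields.BalabanUV.Beta.GAN24.ThreeFaceUnrollSrec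

open Summit.QuantumFields.BalabanUV.Beta.GAN24.ThreeFaceUnroll (threeFace_e3OfK_unroll)

variable {d : ℕ} {Lc : ℕ} [NeZero Lc] {r : Fin (d + 1) → ℕ}

/-- NOT IN PRINT; OUR BOOKKEEPING.  **THE UNROLLING IDENTITY AT THE LEVEL OF THE FOLDED TABLE**: the three-face-legs cell form (period-`P` exit faces) of the
folded member `j+1` splits along `SrecAt_succ` — cubic sector (unrolled by `threeFace_e3OfK_unroll` to `(cE·wE_{j+1})·cH_j³ · 3F_j^{(Lc·P)}`), rooted border (OFF the
ff block, `packVH_inl_inl`), Λ-piece (displayed; its vanishing is the face law (T-H)_face, NOT proved here):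
`3F_{j+1}^{(P)}[SrecAt] = (cE·wE (j+1))·cH_j³·3F_j^{(Lc·P)}[SrecAt] + (cΛ·wΛ (j+1))·ΛF_{j+1}^{(P)}`. -/
theorem threeFace_SrecAt_succ_unroll (hLc : 1 ≤ Lc) (hr : r ∈ box (d + 1) Lc) (cE cVH cΛ : ℝ) (j : ℕ) (γ α β : Fin (d + 1)) (P : ℕ) [NeZero P] :
    (∑ v ∈ box (d + 1) P, (if toSite v γ % (P : ℤ) = (P : ℤ) - 1 then (1 : ℝ) else 0) *
        ∑' yw : Site (d + 1) × Site (d + 1),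
          (if yw.1 α % (P : ℤ) = (P : ℤ) - 1 then (1 : ℝ) else 0) * (if yw.2 β % (P : ℤ) = (P : ℤ) - 1 then (1 : ℝ) else 0) *
            SrecAt d Lc (toSite r) cE cVH cΛ (j + 1) γ (toSite v) yw.1 yw.2 (Sum.inl α) (Sum.inl β))
      = (cE * wE d Lc (j + 1)) * ((stepScale d Lc j * (Lc : ℝ) ^ (d + 1))⁻¹) ^ 3 *
          (∑ τ ∈ box (d + 1) (Lc * P), (if toSite τ γ % ((Lc * P : ℕ) : ℤ) = ((Lc * P : ℕ) : ℤ) - 1 then (1 : ℝ) else 0) *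
            ∑' st : Site (d + 1) × Site (d + 1),
              (if st.1 α % ((Lc * P : ℕ) : ℤ) = ((Lc * P : ℕ) : ℤ) - 1 then (1 : ℝ) else 0) *
                (if st.2 β % ((Lc * P : ℕ) : ℤ) = ((Lc * P : ℕ) : ℤ) - 1 then (1 : ℝ) else 0) *
                SrecAt d Lc (toSite r) cE cVH cΛ j γ (toSite τ) st.1 st.2 (Sum.inl α) (Sum.inl β))
        + (cΛ * wΛ d Lc (j + 1)) *
          (∑ v ∈ box (d + 1) P, (if toSite v γ % (P : ℤ) = (P : ℤ) - 1 then (1 : ℝ) else 0) *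
            ∑' yw : Site (d + 1) × Site (d + 1),
              (if yw.1 α % (P : ℤ) = (P : ℤ) - 1 then (1 : ℝ) else 0) * (if yw.2 β % (P : ℤ) = (P : ℤ) - 1 then (1 : ℝ) else 0) *
                SLam Lc (lamCoeffK (KInvStep (d := d) Lc (j + 1)) (E2 d Lc (j + 1)) Lc) (fun μ y => hessFFAt (toSite r) Lc μ y)
                  γ (toSite v) yw.1 yw.2 (Sum.inl α) (Sum.inl β)) := by
  set w2 : Site (d + 1) × Site (d + 1) → ℝ := fun yw =>
    (if yw.1 α % (P : ℤ) = (P : ℤ) - 1 then (1 : ℝ) else 0) * (if yw.2 β % (P : ℤ) = (P : ℤ) - 1 then (1 : ℝ) else 0) with hw2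
  have hw2b : ∀ yw, |w2 yw| ≤ 1 := by
    intro yw; simp only [hw2]; split_ifs <;> simp
  -- summability of the weighted pair families of `SrecAt (j+1)` and of its cubic sector (bi-localisation), hence of the Λ-piece (difference)
  obtain ⟨Cs1, δ1, hδ1, hS1⟩ := locStencil_SrecAt (d := d) (Lc := Lc) hLc hr cE cVH cΛ (j + 1)
  obtain ⟨Cs, δs, hδs, hSl⟩ := locStencil_SrecAt (d := d) (Lc := Lc) hLc hr cE cVH cΛ j
  obtain ⟨C3, δ3, hδ3, hE3⟩ := locStencil_e3OfK (N := Lc) hLc (decays_coDressKBmAt_KInvStep (d := d) hr j) hSl hδs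
  have key : ∀ v : Fin (d + 1) → ℕ,
      (∑' yw : Site (d + 1) × Site (d + 1), w2 yw * SrecAt d Lc (toSite r) cE cVH cΛ (j + 1) γ (toSite v) yw.1 yw.2 (Sum.inl α) (Sum.inl β))
        = (cE * wE d Lc (j + 1)) * (∑' yw : Site (d + 1) × Site (d + 1),
            w2 yw * e3OfK Lc (coDressKBmAt (toSite r) Lc (KInvStep (d := d) Lc j)) (SrecAt d Lc (toSite r) cE cVH cΛ j) γ (toSite v) yw.1 yw.2 (Sum.inl α) (Sum.inl β))
          + (cΛ * wΛ d Lc (j + 1)) * (∑' yw : Site (d + 1) × Site (d + 1),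
            w2 yw * SLam Lc (lamCoeffK (KInvStep (d := d) Lc (j + 1)) (E2 d Lc (j + 1)) Lc) (fun μ y => hessFFAt (toSite r) Lc μ y)
              γ (toSite v) yw.1 yw.2 (Sum.inl α) (Sum.inl β)) := by
    intro v
    have hsA := LambdaPieceThreeFace.summable_weighted_pairs (hS1 γ (toSite v)) hδ1 (Sum.inl α) (Sum.inl β) w2 hw2b
    have hsE := LambdaPieceThreeFace.summable_weighted_pairs (hE3 γ (toSite v)) hδ3 (Sum.inl α) (Sum.inl β) w2 hw2b
    -- pointwise split along `SrecAt_succ` (the border is off the ff block)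
    have hpt : ∀ yw : Site (d + 1) × Site (d + 1),
        w2 yw * SrecAt d Lc (toSite r) cE cVH cΛ (j + 1) γ (toSite v) yw.1 yw.2 (Sum.inl α) (Sum.inl β)
          = (cE * wE d Lc (j + 1)) * (w2 yw * e3OfK Lc (coDressKBmAt (toSite r) Lc (KInvStep (d := d) Lc j)) (SrecAt d Lc (toSite r) cE cVH cΛ j)
              γ (toSite v) yw.1 yw.2 (Sum.inl α) (Sum.inl β))
            + (cΛ * wΛ d Lc (j + 1)) * (w2 yw * SLam Lc (lamCoeffK (KInvStep (d := d) Lc (j + 1)) (E2 d Lc (j + 1)) Lc)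
              (fun μ y => hessFFAt (toSite r) Lc μ y) γ (toSite v) yw.1 yw.2 (Sum.inl α) (Sum.inl β)) := by
      intro yw
      rw [SrecAt_succ]
      simp only [Pi.add_apply, Pi.smul_apply, smul_eq_mul, AveragingHessianKernelsRooted.vhSAt, packVH_inl_inl, mul_zero, add_zero]
      ring
    -- the Λ family is summable as a difference
    have hsL : Summable fun yw : Site (d + 1) × Site (d + 1) =>
        (cΛ * wΛ d Lc (j + 1)) * (w2 yw * SLam Lc (lamCoeffK (KInvStep (d := d) Lc (j + 1)) (E2 d Lc (j + 1)) Lc)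
          (fun μ y => hessFFAt (toSite r) Lc μ y) γ (toSite v) yw.1 yw.2 (Sum.inl α) (Sum.inl β)) := by
      have h := hsA.sub (hsE.mul_left (cE * wE d Lc (j + 1)))
      refine h.congr fun yw => ?_
      rw [hpt yw]; ring
    rw [tsum_congr hpt, (hsE.mul_left _).tsum_add hsL, tsum_mul_left, tsum_mul_left]
  have hU := threeFace_e3OfK_unroll hLc hr cE cVH cΛ j γ α β P
  simp only [hw2] at key
  rw [Finset.sum_congr rfl fun v _ => by rw [key v]]
  simp only [mul_add, Finset.sum_add_distrib]
  congr 1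
  · rw [mul_assoc, ← hU, Finset.mul_sum]
    exact Finset.sum_congr rfl fun v _ => by ring
  · rw [Finset.mul_sum]
    exact Finset.sum_congr rfl fun v _ => by ring

end Summit.QuantumFields.BalabanUV.Beta.GAN24.ThreeFaceUnrollSrec

end
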